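import Mathlib
import Literature.Geometry.Symplectic.JHolomorphicMap
import Summits.SmoothPoincare4.SmoothPoincare4.Theorems.SullivanDualTameOrBrodyR4AprioriCalculus
import Summits.SmoothPoincare4.SmoothPoincare4.Theorems.SullivanDualTameOrBrodyR4AprioriSource

/-!
# A-priori estimate for `J`-holomorphic maps: part 3, localisation and the energy estimate

Helper file of the lead (c2) for stub `stub_aprioriOf` of line `Sketch`, crux `TameOrBrodyR4`
(stmt-SmoothPoincare4-7826, route SullivanDual). Localisation helpers on `ℂ` (cut-offs, supports, set integrals, basis bounds for squares and fourth powers, word derivatives one and two letters longer), the localised energy estimate `energy_localized` (registered sub-goal; from the `H¹` identity of stub `stub_h1Estimate` with frozen coefficients and absorption), and the pointwise source bound for word derivatives (`source_pointwise`).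
-/

noncomputable section

open scoped ContDiff Topology Nat
open Filter Set Literature.Geometry.Symplectic

-- the registered namespace `Summit.SmoothPoincare4.SmoothPoincare4.…` repeats a component
set_option linter.dupNamespace false

namespace Summit.SmoothPoincare4.SmoothPoincare4.Cruxes.TameOrBrodyR4.Sketch

namespace Apriori

/-! ### Localisation helpers on `ℂ` -/

section StepsHelpers

open MeasureTheory Metric

/-- Local notation for the model space `ℝ⁴ = EuclideanSpace ℝ (Fin 4)`. -/
local notation "E4" => EuclideanSpace ℝ (Fin 4)

variable {G : Type*} [NormedAddCommGroup G] [NormedSpace ℝ G]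

/-- Outside the topological support the derivative vanishes. -/
theorem fderiv_eq_zero_of_notMem_tsupport {f : ℂ → G} {x : ℂ} (hx : x ∉ tsupport f) :
    fderiv ℝ f x = 0 :=
  Function.notMem_support.mp fun h => hx (support_fderiv_subset ℝ h)

omit [NormedSpace ℝ G] in
/-- A function vanishing off the topological support of a compactly supported function has compact
support. -/
theorem hasCompactSupport_of_eq_zero {f : ℂ → G} {H : Type*} [Zero H] {k : ℂ → H}
    (hf : HasCompactSupport f) (h : ∀ x, x ∉ tsupport f → k x = 0) : HasCompactSupport k :=
  HasCompactSupport.intro hf h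

/-- An integral of a function vanishing off a set is the set integral. -/
theorem integral_eq_setIntegral_of_forall {f : ℂ → ℝ} {S : Set ℂ} (h : ∀ x, x ∉ S → f x = 0) :
    ∫ x, f x = ∫ x in S, f x :=
  (setIntegral_eq_integral_of_forall_compl_eq_zero h).symm

/-- The derivative of a localised map `χ • w`. -/
theorem fderiv_smul_apply' {χ : ℂ → ℝ} {w : ℂ → G} (hχ : ContDiff ℝ ∞ χ) (hw : ContDiff ℝ ∞ w)
    (z v : ℂ) : fderiv ℝ (fun y => χ y • w y) z v = χ z • fderiv ℝ w z v + fderiv ℝ χ z v • w z := by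
  rw [fderiv_fun_smul ((hχ.differentiable (by simp)) z) ((hw.differentiable (by simp)) z)]
  simp

/-- Inside the plateau of a bump function, localisation does not change the derivative. -/
theorem fderiv_smul_eq_of_mem {χ : ContDiffBump (0 : ℂ)} {w : ℂ → G} {z : ℂ}
    (hz : z ∈ ball (0 : ℂ) χ.rIn) : fderiv ℝ (fun y => χ y • w y) z = fderiv ℝ w z := by
  apply Filter.EventuallyEq.fderiv_eq
  filter_upwards [χ.eventuallyEq_one_of_mem_ball hz] with y hy
  simp [hy]

/-- A continuous function is integrable on a closed disc. -/
theorem integrableOn_closedBall_of_continuous {f : ℂ → ℝ} (hf : Continuous f) (c : ℂ) (r : ℝ) :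
    IntegrableOn f (closedBall c r) :=
  hf.continuousOn.integrableOn_compact (isCompact_closedBall c r)

/-- `(∑ f i)⁴ ≤ #s³ ∑ f i⁴` for nonnegative `f`. -/
theorem pow_four_sum_le {ι : Type*} (s : Finset ι) {f : ι → ℝ} (hf : ∀ i ∈ s, 0 ≤ f i) :
    (∑ i ∈ s, f i) ^ 4 ≤ (s.card : ℝ) ^ 3 * ∑ i ∈ s, f i ^ 4 :=
  pow_sum_le_card_mul_sum_pow hf 3

/-- Squared basis bound: `‖T‖² ≤ 2ⁿ ∑_L ‖T(e_L)‖²`. -/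
theorem sq_norm_le_of_basis
    (hB : ∀ (n : ℕ) (T : ContinuousMultilinearMap ℝ (fun _ : Fin n => ℂ) E4),
      ‖T‖ ≤ ∑ L : Fin n → Fin 2, ‖T (fun j => ![(1 : ℂ), Complex.I] (L j))‖)
    (n : ℕ) (T : ContinuousMultilinearMap ℝ (fun _ : Fin n => ℂ) E4) :
    ‖T‖ ^ 2 ≤ (2 : ℝ) ^ n * ∑ L : Fin n → Fin 2, ‖T (fun j => ![(1 : ℂ), Complex.I] (L j))‖ ^ 2 := by
  have h := hB n T
  have hcard : ((Finset.univ : Finset (Fin n → Fin 2)).card : ℝ) = 2 ^ n := by simp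
  calc ‖T‖ ^ 2 ≤ (∑ L : Fin n → Fin 2, ‖T (fun j => ![(1 : ℂ), Complex.I] (L j))‖) ^ 2 :=
        pow_le_pow_left₀ (norm_nonneg _) h 2
    _ ≤ _ := by rw [← hcard]; exact sq_sum_le_card_mul_sum_sq

/-- Fourth-power basis bound: `‖T‖⁴ ≤ 8ⁿ ∑_L ‖T(e_L)‖⁴`. -/
theorem pow_four_norm_le_of_basis
    (hB : ∀ (n : ℕ) (T : ContinuousMultilinearMap ℝ (fun _ : Fin n => ℂ) E4),
      ‖T‖ ≤ ∑ L : Fin n → Fin 2, ‖T (fun j => ![(1 : ℂ), Complex.I] (L j))‖)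
    (n : ℕ) (T : ContinuousMultilinearMap ℝ (fun _ : Fin n => ℂ) E4) :
    ‖T‖ ^ 4 ≤ (8 : ℝ) ^ n * ∑ L : Fin n → Fin 2, ‖T (fun j => ![(1 : ℂ), Complex.I] (L j))‖ ^ 4 := by
  have h := hB n T
  have hcard : ((Finset.univ : Finset (Fin n → Fin 2)).card : ℝ) = 2 ^ n := by simp
  calc ‖T‖ ^ 4 ≤ (∑ L : Fin n → Fin 2, ‖T (fun j => ![(1 : ℂ), Complex.I] (L j))‖) ^ 4 :=
        pow_le_pow_left₀ (norm_nonneg _) h 4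
    _ ≤ ((Finset.univ : Finset (Fin n → Fin 2)).card : ℝ) ^ 3 *
          ∑ L : Fin n → Fin 2, ‖T (fun j => ![(1 : ℂ), Complex.I] (L j))‖ ^ 4 :=
        pow_four_sum_le _ fun L _ => norm_nonneg _
    _ = _ := by
        rw [hcard]
        have h8 : ((2 : ℝ) ^ n) ^ 3 = 8 ^ n := by
          rw [← pow_mul, mul_comm, pow_mul]; norm_num
        rw [h8]

/-- A directional derivative of a word derivative is a longer word derivative:
`‖∂_{e_i} (Dⁿg · e_L)(z)‖ ≤ ‖D^{n+1}g(z)‖`. -/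
theorem norm_fderiv_word_le {g : ℂ → E4} (hg : ContDiff ℝ ∞ g) (n : ℕ) (L : Fin n → Fin 2)
    (i : Fin 2) (z : ℂ) :
    ‖fderiv ℝ (iteratedFDeriv ℝ n g · (fun j => ![(1 : ℂ), Complex.I] (L j))) z (![(1 : ℂ), Complex.I] i)‖
      ≤ ‖iteratedFDeriv ℝ (n + 1) g z‖ := by
  have h := iteratedFDeriv_succ_apply_eq_fderiv hg n (Fin.cons (![(1 : ℂ), Complex.I] i)
    (fun j => ![(1 : ℂ), Complex.I] (L j))) z
  simp only [Fin.cons_zero, Fin.tail_cons] at h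
  have htup : (Fin.cons (![(1 : ℂ), Complex.I] i) (fun j => ![(1 : ℂ), Complex.I] (L j)) :
      Fin (n + 1) → ℂ) = fun j => ![(1 : ℂ), Complex.I] ((Fin.cons i L : Fin (n + 1) → Fin 2) j) := by
    funext j
    refine Fin.cases ?_ (fun j => ?_) j <;> simp
  have hgoal : fderiv ℝ (iteratedFDeriv ℝ n g · (fun j => ![(1 : ℂ), Complex.I] (L j))) z
      (![(1 : ℂ), Complex.I] i) = iteratedFDeriv ℝ (n + 1) g z
        (fun j => ![(1 : ℂ), Complex.I] ((Fin.cons i L : Fin (n + 1) → Fin 2) j)) := by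
    rw [← htup]; exact h.symm
  rw [hgoal]
  exact norm_iteratedFDeriv_apply_basis_le g (n + 1) (Fin.cons i L) z

/-- Second directional derivatives of a word derivative:
`‖∂_{e_i} ∂_{e_k} (Dⁿg · e_L)(z)‖ ≤ ‖D^{n+2}g(z)‖`. -/
theorem norm_fderiv_fderiv_word_le {g : ℂ → E4} (hg : ContDiff ℝ ∞ g) (n : ℕ) (L : Fin n → Fin 2)
    (i k : Fin 2) (z : ℂ) :
    ‖fderiv ℝ (fderiv ℝ (iteratedFDeriv ℝ n g · (fun j => ![(1 : ℂ), Complex.I] (L j))) ·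
        (![(1 : ℂ), Complex.I] k)) z (![(1 : ℂ), Complex.I] i)‖ ≤ ‖iteratedFDeriv ℝ (n + 2) g z‖ := by
  -- `∂_k (Dⁿg · e_L) = D^{n+1}g · e_{k::L}`
  have hfun : (fderiv ℝ (iteratedFDeriv ℝ n g · (fun j => ![(1 : ℂ), Complex.I] (L j))) ·
      (![(1 : ℂ), Complex.I] k)) =
      (iteratedFDeriv ℝ (n + 1) g ·
        (fun j => ![(1 : ℂ), Complex.I] ((Fin.cons k L : Fin (n + 1) → Fin 2) j))) := by
    funext y
    have h := iteratedFDeriv_succ_apply_eq_fderiv hg n (Fin.cons (![(1 : ℂ), Complex.I] k)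
      (fun j => ![(1 : ℂ), Complex.I] (L j))) y
    simp only [Fin.cons_zero, Fin.tail_cons] at h
    show fderiv ℝ (iteratedFDeriv ℝ n g · (fun j => ![(1 : ℂ), Complex.I] (L j))) y
        (![(1 : ℂ), Complex.I] k) = iteratedFDeriv ℝ (n + 1) g y _
    rw [← h]
    congr 1
    funext j
    refine Fin.cases ?_ (fun j => ?_) j <;> simp
  rw [hfun]
  exact norm_fderiv_word_le hg (n + 1) (Fin.cons k L) i z

/-- Uniform bound for the derivatives of `J` of order `≤ n` on a closed ball. -/
theorem exists_bound_iteratedFDeriv {J : E4 → E4 →L[ℝ] E4} (hJs : ContDiff ℝ ∞ J) (R₀ : ℝ) (n : ℕ) :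
    ∃ M : ℝ, ∀ i, i ≤ n → ∀ x : E4, ‖x‖ ≤ R₀ → ‖iteratedFDeriv ℝ i J x‖ ≤ M := by
  have h : ∀ i : ℕ, ∃ Mi : ℝ, ∀ x : E4, ‖x‖ ≤ R₀ → ‖iteratedFDeriv ℝ i J x‖ ≤ Mi := fun i => by
    obtain ⟨Mi, hMi⟩ := (isCompact_closedBall (0 : E4) R₀).exists_bound_of_continuousOn
      ((hJs.continuous_iteratedFDeriv (m := i) (by exact_mod_cast le_top)).continuousOn)
    exact ⟨Mi, fun x hx => hMi x (mem_closedBall_zero_iff.mpr hx)⟩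
  choose Mi hMi using h
  refine ⟨∑ i ∈ Finset.range (n + 1), |Mi i|, fun i hi x hx => (hMi i x hx).trans ?_⟩
  exact (le_abs_self _).trans
    (Finset.single_le_sum (fun j _ => abs_nonneg (Mi j)) (Finset.mem_range.mpr (by omega)))

end StepsHelpers

/-! ### The localised energy estimate -/

section Energy

open MeasureTheory Metric

/-- Local notation for the model space `ℝ⁴ = EuclideanSpace ℝ (Fin 4)`. -/
local notation "E4" => EuclideanSpace ℝ (Fin 4)

/-- **Localised energy estimate with frozen coefficients.** From the `H¹` identity (hypothesis
`h1`, stub `stub_h1Estimate`) for the constant structure `A₀` and `‖A - A₀‖ ≤ ε` on the support of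
the cut-off `χ` with `4(1 + ‖A₀‖²)ε² ≤ 1`:
`∫ ‖∂₁(χw)‖² + ‖∂₂(χw)‖² ≤ 4(1 + ‖A₀‖²) ∫ ‖χ (∂₂w - A ∂₁w) + (∂₂χ) w - (∂₁χ) A w‖²`. -/
theorem energy_localized
    (h1 : ∀ (A₀ : E4 →L[ℝ] E4), (∀ v, A₀ (A₀ v) = -v) → ∀ (W : ℂ → E4), ContDiff ℝ ∞ W →
      HasCompactSupport W → (∫ z, (‖fderiv ℝ W z 1‖ ^ 2 + ‖fderiv ℝ W z Complex.I‖ ^ 2)) ≤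
        (1 + ‖A₀‖ ^ 2) * ∫ z, ‖fderiv ℝ W z Complex.I - A₀ (fderiv ℝ W z 1)‖ ^ 2)
    (A₀ : E4 →L[ℝ] E4) (hA₀ : ∀ v, A₀ (A₀ v) = -v) (A : ℂ → E4 →L[ℝ] E4) (hA : Continuous A)
    (w : ℂ → E4) (hw : ContDiff ℝ ∞ w) (χ : ℂ → ℝ) (hχ : ContDiff ℝ ∞ χ)
    (hχc : HasCompactSupport χ) (ε : ℝ) (hε : 4 * (1 + ‖A₀‖ ^ 2) * ε ^ 2 ≤ 1)
    (hAε : ∀ z ∈ tsupport χ, ‖A z - A₀‖ ≤ ε) :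
    (∫ z, (‖fderiv ℝ (fun y => χ y • w y) z 1‖ ^ 2 +
        ‖fderiv ℝ (fun y => χ y • w y) z Complex.I‖ ^ 2)) ≤
      4 * (1 + ‖A₀‖ ^ 2) * ∫ z, ‖χ z • (fderiv ℝ w z Complex.I - A z (fderiv ℝ w z 1)) +
        fderiv ℝ χ z Complex.I • w z - fderiv ℝ χ z 1 • A z (w z)‖ ^ 2 := by
  set W : ℂ → E4 := fun y => χ y • w y with hWdef
  have hW : ContDiff ℝ ∞ W := hχ.smul hw
  have hWc : HasCompactSupport W := hχc.smul_right
  have hdW : ∀ z v, fderiv ℝ W z v = χ z • fderiv ℝ w z v + fderiv ℝ χ z v • w z :=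
    fun z v => fderiv_smul_apply' hχ hw z v
  -- the source `P = ∂₂W - A ∂₁W`
  set P : ℂ → E4 := fun z => χ z • (fderiv ℝ w z Complex.I - A z (fderiv ℝ w z 1)) +
    fderiv ℝ χ z Complex.I • w z - fderiv ℝ χ z 1 • A z (w z) with hPdef
  have hP : ∀ z, fderiv ℝ W z Complex.I - A z (fderiv ℝ W z 1) = P z := by
    intro z
    rw [hdW, hdW]
    simp only [hPdef, map_add, map_smul, smul_sub]
    abel
  -- continuity and compact support of the integrands
  have hcW1 : Continuous fun z => fderiv ℝ W z 1 :=
    (hW.continuous_fderiv (by simp)).clm_apply continuous_const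
  have hcWI : Continuous fun z => fderiv ℝ W z Complex.I :=
    (hW.continuous_fderiv (by simp)).clm_apply continuous_const
  have hcP : Continuous P := by
    have : P = fun z => fderiv ℝ W z Complex.I - A z (fderiv ℝ W z 1) :=
      funext fun z => (hP z).symm
    rw [this]
    exact hcWI.sub (hA.clm_apply hcW1)
  have hzero : ∀ z, z ∉ tsupport χ → fderiv ℝ W z = 0 := by
    intro z hz
    apply fderiv_eq_zero_of_notMem_tsupport
    exact fun h => hz (tsupport_smul_subset_left _ _ h)
  have hsuppE : HasCompactSupport fun z => ‖fderiv ℝ W z 1‖ ^ 2 + ‖fderiv ℝ W z Complex.I‖ ^ 2 :=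
    hasCompactSupport_of_eq_zero hχc fun z hz => by simp [hzero z hz]
  have hsuppP : HasCompactSupport fun z => ‖P z‖ ^ 2 :=
    hasCompactSupport_of_eq_zero hχc fun z hz => by simp [← hP, hzero z hz]
  have hsuppD : HasCompactSupport fun z => ‖fderiv ℝ W z Complex.I - A₀ (fderiv ℝ W z 1)‖ ^ 2 :=
    hasCompactSupport_of_eq_zero hχc fun z hz => by simp [hzero z hz]
  have hiE : Integrable fun z => ‖fderiv ℝ W z 1‖ ^ 2 + ‖fderiv ℝ W z Complex.I‖ ^ 2 :=
    ((hcW1.norm.pow 2).add (hcWI.norm.pow 2)).integrable_of_hasCompactSupport hsuppE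
  have hiP : Integrable fun z => ‖P z‖ ^ 2 := (hcP.norm.pow 2).integrable_of_hasCompactSupport hsuppP
  have hiD : Integrable fun z => ‖fderiv ℝ W z Complex.I - A₀ (fderiv ℝ W z 1)‖ ^ 2 :=
    ((hcWI.sub (A₀.continuous.comp hcW1)).norm.pow 2).integrable_of_hasCompactSupport hsuppD
  -- pointwise: `‖∂₂W - A₀∂₁W‖² ≤ 2‖P‖² + 2ε²(‖∂₁W‖² + ‖∂₂W‖²)`
  have hpt : ∀ z, ‖fderiv ℝ W z Complex.I - A₀ (fderiv ℝ W z 1)‖ ^ 2 ≤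
      2 * ‖P z‖ ^ 2 + 2 * ε ^ 2 * (‖fderiv ℝ W z 1‖ ^ 2 + ‖fderiv ℝ W z Complex.I‖ ^ 2) := by
    intro z
    by_cases hz : z ∈ tsupport χ
    · have hsplit : fderiv ℝ W z Complex.I - A₀ (fderiv ℝ W z 1) =
          P z + (A z - A₀) (fderiv ℝ W z 1) := by
        rw [← hP z, sub_apply]; abel
      have hε0 : 0 ≤ ε := (norm_nonneg _).trans (hAε z hz)
      have hb : ‖(A z - A₀) (fderiv ℝ W z 1)‖ ≤ ε * ‖fderiv ℝ W z 1‖ :=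
        (ContinuousLinearMap.le_opNorm _ _).trans
          (mul_le_mul_of_nonneg_right (hAε z hz) (norm_nonneg _))
      rw [hsplit]
      set X := (A z - A₀) (fderiv ℝ W z 1) with hX
      have hn := norm_add_le (P z) X
      have s1 : ‖P z + X‖ ^ 2 ≤ (‖P z‖ + ‖X‖) ^ 2 := pow_le_pow_left₀ (norm_nonneg _) hn 2
      have s2 : ‖X‖ ^ 2 ≤ (ε * ‖fderiv ℝ W z 1‖) ^ 2 := pow_le_pow_left₀ (norm_nonneg _) hb 2
      have h1' : 0 ≤ ‖fderiv ℝ W z Complex.I‖ ^ 2 := sq_nonneg _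
      have hε2 : 0 ≤ ε ^ 2 := sq_nonneg _
      nlinarith [s1, s2, sq_nonneg (‖P z‖ - ‖X‖), mul_nonneg hε2 h1']
    · have h0 := hzero z hz
      have hl : ‖fderiv ℝ W z Complex.I - A₀ (fderiv ℝ W z 1)‖ = 0 := by rw [h0]; simp
      rw [hl, zero_pow two_ne_zero]
      positivity
  -- integrate and absorb
  have hI := h1 A₀ hA₀ W hW hWc
  have hmono : ∫ z, ‖fderiv ℝ W z Complex.I - A₀ (fderiv ℝ W z 1)‖ ^ 2 ≤
      ∫ z, (2 * ‖P z‖ ^ 2 + 2 * ε ^ 2 * (‖fderiv ℝ W z 1‖ ^ 2 + ‖fderiv ℝ W z Complex.I‖ ^ 2)) :=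
    integral_mono hiD ((hiP.const_mul 2).add (hiE.const_mul (2 * ε ^ 2))) hpt
  have hsplitI : ∫ z, (2 * ‖P z‖ ^ 2 +
      2 * ε ^ 2 * (‖fderiv ℝ W z 1‖ ^ 2 + ‖fderiv ℝ W z Complex.I‖ ^ 2)) =
      2 * (∫ z, ‖P z‖ ^ 2) +
        2 * ε ^ 2 * ∫ z, (‖fderiv ℝ W z 1‖ ^ 2 + ‖fderiv ℝ W z Complex.I‖ ^ 2) := by
    rw [integral_add (hiP.const_mul 2) (hiE.const_mul (2 * ε ^ 2)), integral_const_mul,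
      integral_const_mul]
  set E := ∫ z, (‖fderiv ℝ W z 1‖ ^ 2 + ‖fderiv ℝ W z Complex.I‖ ^ 2) with hEdef
  set Q := ∫ z, ‖P z‖ ^ 2 with hQdef
  have hE0 : 0 ≤ E := integral_nonneg fun z => by positivity
  have hQ0 : 0 ≤ Q := integral_nonneg fun z => by positivity
  have hA0' : 0 ≤ 1 + ‖A₀‖ ^ 2 := by positivity
  have hchain : E ≤ (1 + ‖A₀‖ ^ 2) * (2 * Q + 2 * ε ^ 2 * E) := by
    calc E ≤ (1 + ‖A₀‖ ^ 2) * ∫ z, ‖fderiv ℝ W z Complex.I - A₀ (fderiv ℝ W z 1)‖ ^ 2 := hI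
      _ ≤ (1 + ‖A₀‖ ^ 2) * (2 * Q + 2 * ε ^ 2 * E) := by
          apply mul_le_mul_of_nonneg_left _ hA0'
          rw [← hsplitI]; exact hmono
  -- `2(1+‖A₀‖²)ε² E ≤ E/2`
  have hab : (1 + ‖A₀‖ ^ 2) * (2 * ε ^ 2 * E) ≤ E / 2 := by
    have := mul_le_mul_of_nonneg_right hε hE0
    nlinarith
  nlinarith [hchain, hab, mul_nonneg hA0' hQ0]

end Energy

/-! ### Pointwise preparations for step α -/

section AlphaPrep

open MeasureTheory Metric

/-- Local notation for the model space `ℝ⁴ = EuclideanSpace ℝ (Fin 4)`. -/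
local notation "E4" => EuclideanSpace ℝ (Fin 4)

/-- `‖D¹g(z)‖ = ‖dg(z)‖`. -/
theorem norm_iteratedFDeriv_one_eq {F : Type*} [NormedAddCommGroup F] [NormedSpace ℝ F]
    (g : ℂ → F) (z : ℂ) : ‖iteratedFDeriv ℝ 1 g z‖ = ‖fderiv ℝ g z‖ := by
  rw [← norm_iteratedFDeriv_fderiv, norm_iteratedFDeriv_zero]

/-- The pointwise bound for the source `∂₂w_L - (J∘g) ∂₁w_L` of a word derivative `w_L = Dⁿg · e_L`
(commutator identity + `source_le`). -/
theorem source_pointwise {J : E4 → E4 →L[ℝ] E4} {g : ℂ → E4} (hJs : ContDiff ℝ ∞ J)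
    (hg : ContDiff ℝ ∞ g) (hgJ : IsJHolomorphicFlat J g) {n : ℕ} (hn : 1 ≤ n) {M S : ℝ} (hS : 2 ≤ S)
    (L : Fin n → Fin 2) (z : ℂ) (hM : ∀ i, i ≤ n → ‖iteratedFDeriv ℝ i J (g z)‖ ≤ M)
    (h1 : ‖fderiv ℝ g z‖ ≤ 2) (hlow : ∀ i, 1 ≤ i → i + 2 ≤ n → ‖iteratedFDeriv ℝ i g z‖ ≤ S) :
    ‖fderiv ℝ (iteratedFDeriv ℝ n g · (fun j => ![(1 : ℂ), Complex.I] (L j))) z Complex.I -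
        J (g z) (fderiv ℝ (iteratedFDeriv ℝ n g · (fun j => ![(1 : ℂ), Complex.I] (L j))) z 1)‖ ≤
      (∑ j ∈ Finset.range n,
        (n.choose (j + 1) : ℝ) * (j + 1)! * M * (S ^ (j + 1) + 1 + S ^ 2 + S) * (2 * S)) *
      (1 + ‖iteratedFDeriv ℝ (n - 1) g z‖ ^ 2 + ‖iteratedFDeriv ℝ n g z‖) := by
  rw [commutator_identity hg hgJ]
  refine (ContinuousMultilinearMap.le_opNorm _ _).trans ?_
  have hprod : ∏ j : Fin n, ‖(![(1 : ℂ), Complex.I] : Fin 2 → ℂ) (L j)‖ = 1 :=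
    Finset.prod_eq_one fun j _ => norm_basis_eq_one (L j)
  rw [hprod, mul_one]
  have h1' : ‖iteratedFDeriv ℝ 1 g z‖ ≤ 2 := by rw [norm_iteratedFDeriv_one_eq]; exact h1
  exact source_le hJs hg hn hS z hM h1' hlow

/-- Elementary inequality used to square the pointwise source bound. -/
theorem sq_bound_aux {p C D M x y : ℝ} (hp : 0 ≤ p) (hC : 0 ≤ C) (hD : 0 ≤ D) (hM : 0 ≤ M)
    (hy : 0 ≤ y) (h : p ≤ C * (1 + x ^ 2 + y) + D * y + D * (M * y)) :
    p ^ 2 ≤ 6 * C ^ 2 * (1 + x ^ 4 + y ^ 2) + 2 * D ^ 2 * (1 + M) ^ 2 * y ^ 2 := by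
  have hΛ0 : 0 ≤ 1 + x ^ 2 + y := by positivity
  have hΛ2 : (1 + x ^ 2 + y) ^ 2 ≤ 3 * (1 + x ^ 4 + y ^ 2) := by
    nlinarith [sq_nonneg (x ^ 2 - 1), sq_nonneg (y - 1), sq_nonneg (x ^ 2 - y)]
  have hrhs : 0 ≤ C * (1 + x ^ 2 + y) + D * y + D * (M * y) := by positivity
  have h2 : p ^ 2 ≤ (C * (1 + x ^ 2 + y) + (D * y + D * (M * y))) ^ 2 := by
    rw [← add_assoc]; exact pow_le_pow_left₀ hp h 2
  have h3 : (C * (1 + x ^ 2 + y) + (D * y + D * (M * y))) ^ 2 ≤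
      2 * (C * (1 + x ^ 2 + y)) ^ 2 + 2 * (D * y + D * (M * y)) ^ 2 := by
    nlinarith [sq_nonneg (C * (1 + x ^ 2 + y) - (D * y + D * (M * y)))]
  have h4 : 2 * (C * (1 + x ^ 2 + y)) ^ 2 ≤ 6 * C ^ 2 * (1 + x ^ 4 + y ^ 2) := by
    have := mul_le_mul_of_nonneg_left hΛ2 (by positivity : 0 ≤ 2 * C ^ 2)
    nlinarith
  have h5 : 2 * (D * y + D * (M * y)) ^ 2 = 2 * D ^ 2 * (1 + M) ^ 2 * y ^ 2 := by ring
  linarith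

/-- Comparison of constants in step α. -/
theorem alpha_const_compare {a M₀ Cs Cχ V I4 I2 : ℝ} (ha : 0 ≤ a) (haM : a ≤ M₀) (hV : 0 ≤ V)
    (hI4 : 0 ≤ I4) (hI2 : 0 ≤ I2) :
    4 * (1 + a ^ 2) * (6 * Cs ^ 2 * (V + I4 + I2) + 2 * Cχ ^ 2 * (1 + M₀) ^ 2 * I2) ≤
      4 * (1 + M₀ ^ 2) * (6 * Cs ^ 2 * (V + 1) + 2 * Cχ ^ 2 * (1 + M₀) ^ 2) * (1 + I4 + I2) := by
  have h' : a ^ 2 ≤ M₀ ^ 2 := pow_le_pow_left₀ ha haM 2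
  have h6 : 0 ≤ 6 * Cs ^ 2 := by positivity
  have h2 : 0 ≤ 2 * Cχ ^ 2 * (1 + M₀) ^ 2 := by positivity
  have hVI : V + I4 + I2 ≤ (V + 1) * (1 + I4 + I2) := by nlinarith
  have hI2' : I2 ≤ 1 + I4 + I2 := by linarith
  have hB1 : 6 * Cs ^ 2 * (V + I4 + I2) + 2 * Cχ ^ 2 * (1 + M₀) ^ 2 * I2 ≤
      (6 * Cs ^ 2 * (V + 1) + 2 * Cχ ^ 2 * (1 + M₀) ^ 2) * (1 + I4 + I2) := by
    have := mul_le_mul_of_nonneg_left hVI h6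
    have := mul_le_mul_of_nonneg_left hI2' h2
    nlinarith
  have hB0 : 0 ≤ 6 * Cs ^ 2 * (V + I4 + I2) + 2 * Cχ ^ 2 * (1 + M₀) ^ 2 * I2 :=
    add_nonneg (mul_nonneg h6 (by linarith)) (mul_nonneg h2 hI2)
  have h4 : 4 * (1 + a ^ 2) ≤ 4 * (1 + M₀ ^ 2) := by linarith
  have h40 : 0 ≤ 4 * (1 + M₀ ^ 2) := by positivity
  calc 4 * (1 + a ^ 2) * (6 * Cs ^ 2 * (V + I4 + I2) + 2 * Cχ ^ 2 * (1 + M₀) ^ 2 * I2)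
      ≤ 4 * (1 + M₀ ^ 2) * (6 * Cs ^ 2 * (V + I4 + I2) + 2 * Cχ ^ 2 * (1 + M₀) ^ 2 * I2) :=
        mul_le_mul_of_nonneg_right h4 hB0
    _ ≤ 4 * (1 + M₀ ^ 2) * ((6 * Cs ^ 2 * (V + 1) + 2 * Cχ ^ 2 * (1 + M₀) ^ 2) * (1 + I4 + I2)) :=
        mul_le_mul_of_nonneg_left hB1 h40
    _ = _ := by ring


end AlphaPrep

end Apriori

end Summit.SmoothPoincare4.SmoothPoincare4.Cruxes.TameOrBrodyR4.Sketch
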